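import Summits.ResolutionOfSingularities.ResolutionOfSingularities.Theorems.PurelyInseparableDim4WildConesAllFields
import Summits.ResolutionOfSingularities.ResolutionOfSingularities.Theorems.PurelyInseparableDim4MilnorIsolated
import Mathlib.RingTheory.MvPowerSeries.Substitution
import Mathlib.RingTheory.MvPowerSeries.NoZeroDivisors
import HarnessLib
import HarnessLib.Audit.Tags

/-!
# Purely inseparable four-folds — ISOLATION IS DECIDED IN `K⟦x⟧`, and formal ARCS in the `q`-fold locus
# kill it (bridge WildCones ↔ `PIDim4`, formal side; cell `res-dim4-pi`, p-12, width 12)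

[OURS · counted 0 · commutative-algebra bookkeeping between the cell's polynomial frame and the formal
power series ring; nothing here is a statement about resolution of singularities.]

The frame's `IsIsolated q F` (p-3's Scope add-on) is an algebraic condition on the polynomial ideal
`J_q⁺(F) = ⟨D^{(α)}F : 0 < |α| < q⟩ ⊂ K[x₁..x₄]`: its minimal primes inside `𝔪₀` are `𝔪₀` alone.  The
free-tail lemma (FT) of CARD I-7-2 (`FreeTail.NoIsolatedFreeTailAt`, unproved, load-bearing for the band
half `K2(3)` of `F4-I(3,3)`) ends, in its hand proof (cards/idea-7.md, step (4); res-dim4-p-5's gap memo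
G2), with the sentence «`singLocusIdeal q` extends into the prime `𝔭 = (y)` of the arc in the COMPLETION,
hence is not `𝔪`-primary there, hence `IsIsolated` fails».  This file types exactly that endpoint, for
every `q` and every field:

* §1 For an ARBITRARY polynomial ideal `I ⊂ K[x]`: every element of `I·K⟦x⟧` is a polynomial of `I` up to
  `𝔪̂ⁿ` (`exists_sub_coe_mem_of_mem_map`, truncation); hence `𝔪̂ᴹ ≤ I·K⟦x⟧ ⇒ 𝔪₀ᴹ ≤ I + 𝔪₀ᴹ⁺¹`
  (`certificate_of_maximalIdeal_pow_le_map`) and conversely (`maximalIdeal_pow_le_map_of_certificate`,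
  Nakayama in the local ring `K⟦x⟧`) — generalising p-5's `certificate_of_maximalIdeal_pow_le_span_pderiv`
  and p-12's `maximalIdeal_pow_le_span_pderiv_of_certificate` from the gradient ideal to any `I`.
* §2 **`isIsolated_iff_finite_quotient_map_singLocusIdeal`**:
  `IsIsolated q F ↔ J_q⁺(F) ≤ 𝔪₀ ∧ dim_K K⟦x⟧ ⧸ J_q⁺(F)·K⟦x⟧ < ∞` — isolation is `𝔪̂`-primarity of the
  formal `q`-fold ideal (p-14's certificate `exists_certificate_of_isIsolated`, p-3's
  `isIsolated_of_pow_le_sup_pow_succ`, Literature `FiniteColength`).  At `q = 2` this is the Milnor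
  algebra (`IsolatedBand.isIsolated_two_iff_milnorFinite`); for `q ≥ 3` the ideal is larger than the
  gradient ideal (p-12's gap specimens).
* §3 **ARC CRITERION.** For every ring hom `φ : K⟦x⟧ → R` into a REDUCED ring killing the formal
  `q`-fold ideal: `IsIsolated q F ⇒ φ(xᵢ) = 0` for all `i` (`map_X_eq_zero_of_isIsolated`); so a formal
  arc `γ : Fin 4 → K⟦t⟧`, `γ(0) = 0`, `γ ≠ 0`, with `D^{(α)}F(γ(t)) = 0` for `0 < |α| < q` makes the origin
  a NON-isolated `q`-fold point (`not_isIsolated_of_formalArc`, `MvPowerSeries.subst`); the gradient /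
  Milnor twins `map_X_eq_zero_of_milnorFinite`, `not_milnorFinite_of_formalArc` generalise the axis test
  of `…WildConesGapSpecimen`.

What is NOT here: the straightening dictionary of (FT) steps (1)–(3) (free tail ⇒ smooth formal arc,
directed strict transforms, `ord_y f ≥ q`).  Nothing here proves `NoIsolatedFreeTailAt`, `NoIsolatedTrap`
or resolution of singularities in dimension ≥ 4 / characteristic `p`.
bears_on: LADDER-RESOLUTION:D157-DOOR2 (res-dim4-pi · F4-I(3,3) band half · G2 endpoint).
Supports stmt-ResolutionOfSingularities-16155 (helper).
-/

set_option linter.dupNamespace false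

noncomputable section

namespace Summit.ResolutionOfSingularities.ResolutionOfSingularities.Theorems.PIDim4

namespace FormalIsolation

open MvPolynomial Finset IsLocalRing
open Literature.AlgebraicGeometry.Resolution
open Literature.RingTheory.MvPowerSeries

variable {K : Type} [Field K]

/-! ## 1. Polynomial ideals extended to `K⟦x⟧`: truncation and Nakayama -/

/-- **Every element of `I·K⟦x⟧` is a polynomial of `I` up to `𝔪̂ⁿ`**: for `x ∈ I.map (K[x] → K⟦x⟧)` and
every `n` there is `G ∈ I` with `x − ↑G ∈ 𝔪̂ⁿ` (replace the power-series coefficients of a combination of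
generators by their jets of order `n`). [folklore] -/
theorem exists_sub_coe_mem_of_mem_map {I : Ideal (MvPolynomial (Fin 4) K)} {x : MvPowerSeries (Fin 4) K}
    (hx : x ∈ I.map (MvPolynomial.coeToMvPowerSeries.ringHom : MvPolynomial (Fin 4) K →+* _)) (n : ℕ) :
    ∃ G ∈ I, x - (G : MvPowerSeries (Fin 4) K) ∈ maximalIdeal (MvPowerSeries (Fin 4) K) ^ n := by
  rw [Ideal.map] at hx
  induction hx using Submodule.span_induction with
  | mem y hy =>
    obtain ⟨G, hG, rfl⟩ := hy
    exact ⟨G, hG, by rw [MvPolynomial.coeToMvPowerSeries.ringHom_apply, sub_self]; exact zero_mem _⟩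
  | zero => exact ⟨0, zero_mem _, by rw [MvPolynomial.coe_zero, sub_zero]; exact zero_mem _⟩
  | add y z _ _ hy hz =>
    obtain ⟨G, hG, hyG⟩ := hy
    obtain ⟨H, hH, hzH⟩ := hz
    refine ⟨G + H, add_mem hG hH, ?_⟩
    have : y + z - ((G + H : MvPolynomial (Fin 4) K) : MvPowerSeries (Fin 4) K) =
        (y - G) + (z - H) := by
      rw [MvPolynomial.coe_add]; ring
    rw [this]
    exact add_mem hyG hzH
  | smul a y _ hy =>
    obtain ⟨G, hG, hyG⟩ := hy
    refine ⟨MvPowerSeries.truncTotal n a * G, Ideal.mul_mem_left _ _ hG, ?_⟩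
    have : a • y - ((MvPowerSeries.truncTotal n a * G : MvPolynomial (Fin 4) K) :
        MvPowerSeries (Fin 4) K) =
        a * (y - G) + (a - (MvPowerSeries.truncTotal n a : MvPolynomial (Fin 4) K)) * G := by
      rw [smul_eq_mul, MvPolynomial.coe_mul]; ring
    rw [this]
    exact add_mem (Ideal.mul_mem_left _ _ hyG)
      (Ideal.mul_mem_right _ _ (Jets.sub_coe_truncTotal_mem_maximalIdeal_pow n a))

/-- **Truncation turns a formal inclusion into a certificate** (any polynomial ideal `I`):
`𝔪̂ᴹ ≤ I·K⟦x⟧ ⇒ 𝔪₀ᴹ ≤ I + 𝔪₀ᴹ⁺¹`. [folklore] -/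
theorem certificate_of_maximalIdeal_pow_le_map {I : Ideal (MvPolynomial (Fin 4) K)} {M : ℕ}
    (h : maximalIdeal (MvPowerSeries (Fin 4) K) ^ M ≤
      I.map (MvPolynomial.coeToMvPowerSeries.ringHom : MvPolynomial (Fin 4) K →+* _)) :
    originIdeal K ^ M ≤ I ⊔ originIdeal K ^ (M + 1) := by
  refine IsolationCert.pow_le_sup_pow_succ_of_forall_monomial fun γ hγ => ?_
  have hmem : ((monomial γ (1 : K) : MvPolynomial (Fin 4) K) : MvPowerSeries (Fin 4) K) ∈
      I.map (MvPolynomial.coeToMvPowerSeries.ringHom : MvPolynomial (Fin 4) K →+* _) := by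
    refine h ?_
    rw [MvPolynomial.coe_monomial]
    exact Jets.monomial_mem_maximalIdeal_pow hγ.ge 1
  obtain ⟨G, hG, hsub⟩ := exists_sub_coe_mem_of_mem_map hmem (M + 1)
  refine IsolationCert.monomial_mem_sup_of_sub_mem hG ?_
  have hcoe : (((monomial γ (1 : K) : MvPolynomial (Fin 4) K) - G : MvPolynomial (Fin 4) K) :
      MvPowerSeries (Fin 4) K) =
      ((monomial γ (1 : K) : MvPolynomial (Fin 4) K) : MvPowerSeries (Fin 4) K) -
        (G : MvPowerSeries (Fin 4) K) :=
    map_sub (MvPolynomial.coeToMvPowerSeries.ringHom (σ := Fin 4) (R := K)) _ _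
  rw [← IsolatedBand.coe_mem_maximalIdeal_pow_iff, hcoe]
  exact hsub

/-- **Nakayama turns a certificate into a formal inclusion** (any polynomial ideal `I`):
`𝔪₀ᴺ ≤ I + 𝔪₀ᴺ⁺¹ ⇒ 𝔪̂ᴺ ≤ I·K⟦x⟧` (`𝔪₀·K⟦x⟧ = 𝔪̂` is the Jacobson radical of the local ring `K⟦x⟧`).
[folklore] -/
theorem maximalIdeal_pow_le_map_of_certificate {I : Ideal (MvPolynomial (Fin 4) K)} {N : ℕ}
    (hN : originIdeal K ^ N ≤ I ⊔ originIdeal K ^ (N + 1)) :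
    maximalIdeal (MvPowerSeries (Fin 4) K) ^ N ≤
      I.map (MvPolynomial.coeToMvPowerSeries.ringHom : MvPolynomial (Fin 4) K →+* _) := by
  set φ : MvPolynomial (Fin 4) K →+* MvPowerSeries (Fin 4) K := MvPolynomial.coeToMvPowerSeries.ringHom
    with hφ
  have h := Ideal.map_mono (f := φ) hN
  rw [Ideal.map_sup, Ideal.map_pow, Ideal.map_pow, hφ, WildConesBridge.map_originIdeal_coe] at h
  refine Submodule.le_of_le_smul_of_le_jacobson_bot (I := maximalIdeal (MvPowerSeries (Fin 4) K))
    (Ideal.FG.pow WildConesBridge.maximalIdeal_fg) (IsLocalRing.jacobson_eq_maximalIdeal ⊥ bot_ne_top).ge ?_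
  rwa [Ideal.smul_eq_mul, ← pow_succ']

/-- So **`I·K⟦x⟧` is `𝔪̂`-primary with exponent read off a certificate and vice versa**:
`(∃ N, 𝔪̂ᴺ ≤ I·K⟦x⟧) ↔ ∃ N, 𝔪₀ᴺ ≤ I + 𝔪₀ᴺ⁺¹`. [folklore] -/
theorem exists_maximalIdeal_pow_le_map_iff (I : Ideal (MvPolynomial (Fin 4) K)) :
    (∃ N : ℕ, maximalIdeal (MvPowerSeries (Fin 4) K) ^ N ≤
      I.map (MvPolynomial.coeToMvPowerSeries.ringHom : MvPolynomial (Fin 4) K →+* _)) ↔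
      ∃ N : ℕ, originIdeal K ^ N ≤ I ⊔ originIdeal K ^ (N + 1) :=
  ⟨fun ⟨N, h⟩ => ⟨N, certificate_of_maximalIdeal_pow_le_map h⟩,
    fun ⟨N, h⟩ => ⟨N, maximalIdeal_pow_le_map_of_certificate h⟩⟩

/-- `I·K⟦x⟧` has finite colength iff some power of `𝔪̂` lies in it. [folklore] -/
theorem finite_quotient_map_iff (I : Ideal (MvPolynomial (Fin 4) K)) :
    Module.Finite K (MvPowerSeries (Fin 4) K ⧸
      I.map (MvPolynomial.coeToMvPowerSeries.ringHom : MvPolynomial (Fin 4) K →+* _)) ↔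
      ∃ N : ℕ, maximalIdeal (MvPowerSeries (Fin 4) K) ^ N ≤
        I.map (MvPolynomial.coeToMvPowerSeries.ringHom : MvPolynomial (Fin 4) K →+* _) := by
  constructor
  · intro hfin
    exact WildConesBridge.exists_maximalIdeal_pow_le_of_finite hfin
  · rintro ⟨N, hN⟩
    haveI := Jets.finite_quotient_maximalIdeal_pow (σ := Fin 4) (K := K) N
    exact Module.Finite.of_surjective (Ideal.Quotient.factorₐ K hN).toLinearMap
      (Ideal.Quotient.factor_surjective hN)

/-! ## 2. Isolation is decided in the completion -/

/-- **An ISOLATED `q`-fold point has `𝔪̂`-primary formal `q`-fold ideal**: `IsIsolated q F ⇒ ∃ N,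
𝔪̂ᴺ ≤ J_q⁺(F)·K⟦x⟧` (p-14's certificate, then Nakayama). [folklore] -/
theorem exists_maximalIdeal_pow_le_map_singLocusIdeal {q : ℕ} {F : MvPolynomial (Fin 4) K}
    (hiso : IsIsolated q F) :
    ∃ N : ℕ, maximalIdeal (MvPowerSeries (Fin 4) K) ^ N ≤
      (singLocusIdeal q F).map
        (MvPolynomial.coeToMvPowerSeries.ringHom : MvPolynomial (Fin 4) K →+* _) := by
  obtain ⟨N, hN⟩ := IsolationConverse.exists_certificate_of_isIsolated hiso
  exact ⟨N, maximalIdeal_pow_le_map_of_certificate hN⟩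

/-- Hence **`K⟦x⟧ ⧸ J_q⁺(F)·K⟦x⟧` is finite over `K` at an isolated `q`-fold point**. [folklore] -/
theorem finite_quotient_map_singLocusIdeal_of_isIsolated {q : ℕ} {F : MvPolynomial (Fin 4) K}
    (hiso : IsIsolated q F) :
    Module.Finite K (MvPowerSeries (Fin 4) K ⧸ (singLocusIdeal q F).map
      (MvPolynomial.coeToMvPowerSeries.ringHom : MvPolynomial (Fin 4) K →+* _)) :=
  (finite_quotient_map_iff _).mpr (exists_maximalIdeal_pow_le_map_singLocusIdeal hiso)

/-- Conversely **finite colength of the formal `q`-fold ideal at a `q`-fold point gives isolation**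
(truncate to a certificate, then p-3's certificate lemma). [folklore] -/
theorem isIsolated_of_finite_quotient_map_singLocusIdeal {q : ℕ} {F : MvPolynomial (Fin 4) K}
    (hJ : singLocusIdeal q F ≤ originIdeal K)
    (hfin : Module.Finite K (MvPowerSeries (Fin 4) K ⧸ (singLocusIdeal q F).map
      (MvPolynomial.coeToMvPowerSeries.ringHom : MvPolynomial (Fin 4) K →+* _))) :
    IsIsolated q F := by
  obtain ⟨N, hN⟩ := (finite_quotient_map_iff _).mp hfin
  exact IsolationCert.isIsolated_of_pow_le_sup_pow_succ hJ (certificate_of_maximalIdeal_pow_le_map hN)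

/-- **ISOLATION IS DECIDED IN THE COMPLETION**: `IsIsolated q F ↔ J_q⁺(F) ≤ 𝔪₀ ∧
dim_K K⟦x⟧ ⧸ J_q⁺(F)·K⟦x⟧ < ∞` — the frame's algebraic isolation of the `q`-fold point is
`𝔪̂`-primarity of the formal `q`-fold ideal (the sentence «an ideal is `𝔪`-primary iff its completion
is» of (FT) step (4)).  At `q = 2` this is `IsolatedBand.isIsolated_two_iff_milnorFinite`. [folklore] -/
theorem isIsolated_iff_finite_quotient_map_singLocusIdeal {q : ℕ} {F : MvPolynomial (Fin 4) K} :
    IsIsolated q F ↔ singLocusIdeal q F ≤ originIdeal K ∧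
      Module.Finite K (MvPowerSeries (Fin 4) K ⧸ (singLocusIdeal q F).map
        (MvPolynomial.coeToMvPowerSeries.ringHom : MvPolynomial (Fin 4) K →+* _)) :=
  ⟨fun h => ⟨h.1, finite_quotient_map_singLocusIdeal_of_isIsolated h⟩,
    fun h => isIsolated_of_finite_quotient_map_singLocusIdeal h.1 h.2⟩

/-! ## 3. The arc criterion -/

/-- A ring hom out of `K⟦x⟧` into a REDUCED ring that kills an `𝔪̂`-primary ideal kills the
variables. [folklore] -/
theorem map_X_eq_zero_of_maximalIdeal_pow_le {R : Type} [CommRing R] [IsReduced R]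
    (φ : MvPowerSeries (Fin 4) K →+* R) {J : Ideal (MvPowerSeries (Fin 4) K)}
    (hφ : ∀ x ∈ J, φ x = 0) {N : ℕ} (hN : maximalIdeal (MvPowerSeries (Fin 4) K) ^ N ≤ J)
    (i : Fin 4) : φ (MvPowerSeries.X i) = 0 := by
  have hX : (MvPowerSeries.X i : MvPowerSeries (Fin 4) K) ^ N ∈ J := by
    refine hN (Ideal.pow_mem_pow ?_ N)
    rw [WildConesBridge.maximalIdeal_eq_span_X]
    exact Ideal.subset_span ⟨i, rfl⟩
  have h0 : φ (MvPowerSeries.X i) ^ N = 0 := by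
    rw [← map_pow]
    exact hφ _ hX
  exact IsNilpotent.eq_zero ⟨N, h0⟩

/-- The formal `q`-fold ideal `J_q⁺(F)·K⟦x⟧` lies in the kernel of any ring hom killing the Hasse
derivatives `D^{(α)}F`, `0 < |α| < q`. [folklore] -/
theorem map_singLocusIdeal_le_ker {R : Type} [CommRing R] (φ : MvPowerSeries (Fin 4) K →+* R) {q : ℕ}
    {F : MvPolynomial (Fin 4) K}
    (hφ : ∀ α : Fin 4 →₀ ℕ, 0 < α.degree → α.degree < q →
      φ ((hasseDeriv α F : MvPolynomial (Fin 4) K) : MvPowerSeries (Fin 4) K) = 0) :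
    (singLocusIdeal q F).map
        (MvPolynomial.coeToMvPowerSeries.ringHom : MvPolynomial (Fin 4) K →+* _) ≤ RingHom.ker φ := by
  rw [Ideal.map_le_iff_le_comap]
  unfold singLocusIdeal
  rw [Ideal.span_le]
  rintro _ ⟨α, h0, hq, rfl⟩
  rw [SetLike.mem_coe, Ideal.mem_comap, RingHom.mem_ker, MvPolynomial.coeToMvPowerSeries.ringHom_apply]
  exact hφ α h0 hq

/-- **ARC CRITERION (homomorphism form).** If `φ : K⟦x⟧ → R`, `R` reduced, kills every `D^{(α)}F`
(`0 < |α| < q`), then at an ISOLATED `q`-fold point `φ` kills all the variables: no non-constant reduced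
point — in particular no non-constant formal arc — lies in the formal `q`-fold locus. [folklore] -/
theorem map_X_eq_zero_of_isIsolated {R : Type} [CommRing R] [IsReduced R]
    (φ : MvPowerSeries (Fin 4) K →+* R) {q : ℕ} {F : MvPolynomial (Fin 4) K}
    (hφ : ∀ α : Fin 4 →₀ ℕ, 0 < α.degree → α.degree < q →
      φ ((hasseDeriv α F : MvPolynomial (Fin 4) K) : MvPowerSeries (Fin 4) K) = 0)
    (hiso : IsIsolated q F) (i : Fin 4) : φ (MvPowerSeries.X i) = 0 := by
  obtain ⟨N, hN⟩ := exists_maximalIdeal_pow_le_map_singLocusIdeal hiso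
  exact map_X_eq_zero_of_maximalIdeal_pow_le φ
    (fun x hx => RingHom.mem_ker.mp (map_singLocusIdeal_le_ker φ hφ hx)) hN i

/-- Contrapositive: **a ring hom into a reduced ring killing the `D^{(α)}F` but not all variables
exhibits a NON-isolated `q`-fold point.** [folklore] -/
theorem not_isIsolated_of_map_hasseDeriv_eq_zero {R : Type} [CommRing R] [IsReduced R]
    (φ : MvPowerSeries (Fin 4) K →+* R) {q : ℕ} {F : MvPolynomial (Fin 4) K}
    (hφ : ∀ α : Fin 4 →₀ ℕ, 0 < α.degree → α.degree < q →
      φ ((hasseDeriv α F : MvPolynomial (Fin 4) K) : MvPowerSeries (Fin 4) K) = 0)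
    (hi : ∃ i : Fin 4, φ (MvPowerSeries.X i) ≠ 0) : ¬ IsIsolated q F := fun hiso => by
  obtain ⟨i, hi⟩ := hi
  exact hi (map_X_eq_zero_of_isIsolated φ hφ hiso i)

/-- **ARC CRITERION (formal arcs).** A formal arc `γ = (γ₁(t), …, γ₄(t))`, `γᵢ(0) = 0`, not identically
zero, along which every `D^{(α)}F` (`0 < |α| < q`) vanishes identically in `K⟦t⟧`, makes the origin a
NON-isolated `q`-fold point of `z^q + F` — the endpoint of (FT)'s hand proof, step (4).  (Arcs are
substitutions `MvPowerSeries.subst γ : K⟦x⟧ → K⟦t⟧`; on polynomials they act by `MvPolynomial.aeval γ`.)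
[folklore] -/
theorem not_isIsolated_of_formalArc {q : ℕ} {F : MvPolynomial (Fin 4) K}
    (γ : Fin 4 → MvPowerSeries Unit K) (h0 : ∀ i, MvPowerSeries.constantCoeff (γ i) = 0)
    (hne : ∃ i, γ i ≠ 0)
    (hvan : ∀ α : Fin 4 →₀ ℕ, 0 < α.degree → α.degree < q →
      MvPolynomial.aeval γ (hasseDeriv α F) = 0) :
    ¬ IsIsolated q F := by
  have ha : MvPowerSeries.HasSubst γ := MvPowerSeries.hasSubst_of_constantCoeff_zero h0
  refine not_isIsolated_of_map_hasseDeriv_eq_zero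
    ((MvPowerSeries.substAlgHom (R := K) ha).toRingHom) (fun α hα0 hαq => ?_) ?_
  · rw [AlgHom.toRingHom_eq_coe, RingHom.coe_coe, MvPowerSeries.substAlgHom_coe, hvan α hα0 hαq]
  · obtain ⟨i, hi⟩ := hne
    refine ⟨i, ?_⟩
    rwa [AlgHom.toRingHom_eq_coe, RingHom.coe_coe, MvPowerSeries.substAlgHom_X]

/-! ### The gradient / Milnor twins -/

/-- **A ring hom into a reduced ring killing the gradient of `F` kills the variables when the formal
Milnor algebra is FINITE.** [folklore] -/
theorem map_X_eq_zero_of_milnorFinite {R : Type} [CommRing R] [IsReduced R]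
    (φ : MvPowerSeries (Fin 4) K →+* R) {F : MvPolynomial (Fin 4) K}
    (hφ : ∀ t : Fin 4, φ (MvPowerSeries.pderiv t (F : MvPowerSeries (Fin 4) K)) = 0)
    (hfin : Module.Finite K (MvPowerSeries (Fin 4) K ⧸
      Ideal.span (Set.range fun t : Fin 4 => MvPowerSeries.pderiv t (F : MvPowerSeries (Fin 4) K))))
    (i : Fin 4) : φ (MvPowerSeries.X i) = 0 := by
  obtain ⟨N, hN⟩ := WildConesBridge.exists_maximalIdeal_pow_le_of_finite hfin
  refine map_X_eq_zero_of_maximalIdeal_pow_le φ (fun x hx => ?_) hN i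
  have hle : Ideal.span (Set.range fun t : Fin 4 =>
      MvPowerSeries.pderiv t (F : MvPowerSeries (Fin 4) K)) ≤ RingHom.ker φ := by
    rw [Ideal.span_le]
    rintro _ ⟨t, rfl⟩
    exact hφ t
  exact RingHom.mem_ker.mp (hle hx)

/-- **A non-zero formal arc in the formal critical locus makes the Milnor algebra INFINITE**
(`∂ₜF(γ(t)) = 0` for all `t`, `γ(0) = 0`, `γ ≠ 0`); the axis arcs `t ↦ t·eᵢ` give the test
`WildConesBridge.not_milnorFinite_of_coeff_single_pderiv_eq_zero`. [folklore] -/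
theorem not_milnorFinite_of_formalArc {F : MvPolynomial (Fin 4) K}
    (γ : Fin 4 → MvPowerSeries Unit K) (h0 : ∀ i, MvPowerSeries.constantCoeff (γ i) = 0)
    (hne : ∃ i, γ i ≠ 0) (hvan : ∀ t : Fin 4, MvPolynomial.aeval γ (pderiv t F) = 0) :
    ¬ Module.Finite K (MvPowerSeries (Fin 4) K ⧸
      Ideal.span (Set.range fun t : Fin 4 => MvPowerSeries.pderiv t (F : MvPowerSeries (Fin 4) K))) := by
  intro hfin
  have ha : MvPowerSeries.HasSubst γ := MvPowerSeries.hasSubst_of_constantCoeff_zero h0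
  obtain ⟨i, hi⟩ := hne
  apply hi
  have h := map_X_eq_zero_of_milnorFinite ((MvPowerSeries.substAlgHom (R := K) ha).toRingHom)
    (F := F) (fun t => ?_) hfin i
  · rwa [AlgHom.toRingHom_eq_coe, RingHom.coe_coe, MvPowerSeries.substAlgHom_X] at h
  · rw [AlgHom.toRingHom_eq_coe, RingHom.coe_coe, MvPowerSeries.pderiv_coe,
      MvPowerSeries.substAlgHom_coe, hvan t]

end FormalIsolation

end Summit.ResolutionOfSingularities.ResolutionOfSingularities.Theorems.PIDim4

end
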